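import Summits.QuantumAdvantage.QuantumAdvantage.Theorems.NearExactIsExact.Negative.CornerFlatThreeFlat
import Literature.Computability.QuantumComplexity.QuadraticPolarForm

/-!
# Corner-flat pairs of rank 4, IV-a: sixteen-corner sums and the Pfaffian of the Plücker 2-vector

Negative-side (disprover lane, unit `b2b-cforr-disprove-g33`, 2026-08-23) toolkit for the FRAME-FREE form of the
rank-4 isotropy ceiling (`Negative/CornerFlatRankFourFrameFree.lean`) for the crux
`CubicForrelation.NearExactIsExact`.  A rank-4 corner-flat fibre is the affine 4-flat of sixteen corners
`w ⊕ q₁₁u₁ ⊕ q₁₂u₂ ⊕ q₂₁u₃ ⊕ q₂₂u₄`, `q ∈ (𝔽₂²)²`.  Summing a monomial `y_S` over the sixteen corners is a fourth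
derivative, so it vanishes for `|S| ≤ 3` and for `S = {i,j,k,l}` it is the `4 × 4` minor
`det(u₁,u₂,u₃,u₄)_S`, which modulo `2` is the PFAFFIAN `B_ij B_kl ⊕ B_ik B_jl ⊕ B_il B_jk` of the Plücker 2-vector
`B = u₁∧u₂ ⊕ u₃∧u₄` — independent of the base point `w` and QUADRATIC in `B`.

* `cfz_sum1/2/3` — unbased sums of `1,2,3` frame forms vanish (`decide`);
* `cfz_sum4` — unbased sum of `4` frame forms `=` Pfaffian: a polynomial identity that holds only modulo `2`,
  certified as `LHS - RHS = 2·R` with an explicit integer cofactor `R` (232 monomials, generated by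
  `code/disprove-g33/amm4/gen_sixteen_file.py` in the unit's HOME) and closed by `linear_combination`;
* `cfs_expand3/4` — translation by the base point: `Π (W_t + Z_t)` expanded, lower sums killed;
* `cfs_based1..4` — the based sixteen-corner sums; `cfs_flat_sum_le3`, `cfs_flat_sum4` — the same for a
  monomial `Π_{t ∈ S}` over a `Finset` of coordinates (`|S| ≤ 3`: zero; `|S| = 4`: Pfaffian).

Standard three axioms only (no `native_decide`).
-/

set_option linter.dupNamespace false -- D-0017: single-problem summit ⇒ `QuantumAdvantage.QuantumAdvantage` by design

noncomputable section

namespace Summit.QuantumAdvantage.QuantumAdvantage.Theorems.NearExactIsExact.Negative.CornerFlatRankFour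

open Finset
open Literature.Computability.QuantumComplexity.QuadPolar (two_eq_zero)
open Summit.QuantumAdvantage.QuantumAdvantage.Theorems.NearExactIsExact.Negative.SkewProductCore (ind ind_and ind_xor
  ind_true ind_false)

variable {m : ℕ}

/-! ### Unbased sixteen-corner sums of frame forms `z_t(q) = q₁₁aₜ ⊕ q₁₂bₜ ⊕ q₂₁cₜ ⊕ q₂₂dₜ` -/

/-- `Σ_q z_t(q) = 0` over the sixteen corners, in `𝔽₂`. [folklore] -/
theorem cfz_sum1 : ∀ a b c d : Bool,
    (∑ q : (Bool × Bool) × (Bool × Bool), ind (((q.1.1 && a) ^^ (q.1.2 && b)) ^^ (q.2.1 && c) ^^ (q.2.2 && d))) = 0 := by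
  intro a b c d
  simp only [Fintype.sum_prod_type, Fintype.sum_bool]
  cases a <;> cases b <;> cases c <;> cases d <;> decide

/-- `Σ_q z_s(q) z_t(q) = 0`. [folklore] -/
theorem cfz_sum2 : ∀ a b c d a' b' c' d' : Bool,
    (∑ q : (Bool × Bool) × (Bool × Bool), ind (((q.1.1 && a) ^^ (q.1.2 && b)) ^^ (q.2.1 && c) ^^ (q.2.2 && d)) *
      ind (((q.1.1 && a') ^^ (q.1.2 && b')) ^^ (q.2.1 && c') ^^ (q.2.2 && d'))) = 0 := by
  intro a b c d
  simp only [Fintype.sum_prod_type, Fintype.sum_bool]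
  cases a <;> cases b <;> cases c <;> cases d <;> decide

/-- `Σ_q z_r(q) z_s(q) z_t(q) = 0` (a fourth derivative of a cubic monomial). [folklore] -/
theorem cfz_sum3 : ∀ a b c d a' b' c' d' a'' b'' c'' d'' : Bool,
    (∑ q : (Bool × Bool) × (Bool × Bool), ind (((q.1.1 && a) ^^ (q.1.2 && b)) ^^ (q.2.1 && c) ^^ (q.2.2 && d)) *
      (ind (((q.1.1 && a') ^^ (q.1.2 && b')) ^^ (q.2.1 && c') ^^ (q.2.2 && d')) *
        ind (((q.1.1 && a'') ^^ (q.1.2 && b'')) ^^ (q.2.1 && c'') ^^ (q.2.2 && d'')))) = 0 := by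
  intro a b c d a' b' c' d'
  simp only [Fintype.sum_prod_type, Fintype.sum_bool]
  cases a <;> cases b <;> cases c <;> cases d <;> cases a' <;> cases b' <;> cases c' <;> cases d' <;> decide

/-- **Fourth derivative of a quartic monomial = Pfaffian of the Plücker 2-vector.**
`Σ_q z₁(q) z₂(q) z₃(q) z₄(q) = B₁₂B₃₄ ⊕ B₁₃B₂₄ ⊕ B₁₄B₂₃` with `B_st = a_s b_t ⊕ a_t b_s ⊕ c_s d_t ⊕ c_t d_s`
(`= det` of the `4 × 4` matrix `(a,b,c,d)`, modulo `2`).  The identity holds only modulo `2`; it is certified by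
the integer cofactor `R` below (`LHS - RHS = 2R` in `ℤ[ind a₁, …, ind d₄]`). [folklore] -/
theorem cfz_sum4 (a1 b1 c1 d1 a2 b2 c2 d2 a3 b3 c3 d3 a4 b4 c4 d4 : Bool) :
    (∑ q : (Bool × Bool) × (Bool × Bool), ind (((q.1.1 && a1) ^^ (q.1.2 && b1)) ^^ (q.2.1 && c1) ^^ (q.2.2 && d1)) * (ind (((q.1.1 && a2) ^^ (q.1.2 && b2)) ^^ (q.2.1 && c2) ^^ (q.2.2 && d2)) *
      (ind (((q.1.1 && a3) ^^ (q.1.2 && b3)) ^^ (q.2.1 && c3) ^^ (q.2.2 && d3)) * ind (((q.1.1 && a4) ^^ (q.1.2 && b4)) ^^ (q.2.1 && c4) ^^ (q.2.2 && d4))))) =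
      ind (((((a1 && b2) ^^ (a2 && b1)) ^^ ((c1 && d2) ^^ (c2 && d1))) && (((a3 && b4) ^^ (a4 && b3)) ^^ ((c3 && d4) ^^ (c4 && d3)))) ^^ ((((a1 && b3) ^^ (a3 && b1)) ^^ ((c1 && d3) ^^ (c3 && d1))) && (((a2 && b4) ^^ (a4 && b2)) ^^ ((c2 && d4) ^^ (c4 && d2)))) ^^ ((((a1 && b4) ^^ (a4 && b1)) ^^ ((c1 && d4) ^^ (c4 && d1))) && (((a2 && b3) ^^ (a3 && b2)) ^^ ((c2 && d3) ^^ (c3 && d2))))) := by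
  simp only [Fintype.sum_prod_type, Fintype.sum_bool]
  simp only [Bool.true_and, Bool.false_and, Bool.xor_false, Bool.false_xor]
  simp only [ind_xor, ind_and]
  rw [ind_false]
  linear_combination
    (4 * ind a1 * ind a2 * ind a3 * ind a4 + 2 * ind a1 * ind a2 * ind a3 * ind b4 + 2 * ind a1 * ind a2 * ind a3 * ind c4 + 2 * ind a1 * ind a2 * ind a3 * ind d4
      + 2 * ind a1 * ind a2 * ind a4 * ind b3 + 2 * ind a1 * ind a2 * ind a4 * ind c3 + 2 * ind a1 * ind a2 * ind a4 * ind d3 + ind a1 * ind a2 * ind b3 * ind b4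
      + ind a1 * ind a2 * ind b3 * ind c4 + ind a1 * ind a2 * ind b3 * ind d4 + ind a1 * ind a2 * ind b4 * ind c3 + ind a1 * ind a2 * ind b4 * ind d3
      + 2 * ind a1 * ind a2 * ind c3 * ind c4 + ind a1 * ind a2 * ind c3 * ind d4 + ind a1 * ind a2 * ind c4 * ind d3 + 2 * ind a1 * ind a2 * ind d3 * ind d4
      + 2 * ind a1 * ind a3 * ind a4 * ind b2 + 2 * ind a1 * ind a3 * ind a4 * ind c2 + 2 * ind a1 * ind a3 * ind a4 * ind d2 + ind a1 * ind a3 * ind b2 * ind b4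
      + ind a1 * ind a3 * ind b2 * ind c4 + ind a1 * ind a3 * ind b2 * ind d4 + ind a1 * ind a3 * ind b4 * ind c2 + ind a1 * ind a3 * ind b4 * ind d2
      + 2 * ind a1 * ind a3 * ind c2 * ind c4 + ind a1 * ind a3 * ind c2 * ind d4 + ind a1 * ind a3 * ind c4 * ind d2 + 2 * ind a1 * ind a3 * ind d2 * ind d4
      + ind a1 * ind a4 * ind b2 * ind b3 + ind a1 * ind a4 * ind b2 * ind c3 + ind a1 * ind a4 * ind b2 * ind d3 + ind a1 * ind a4 * ind b3 * ind c2
      + ind a1 * ind a4 * ind b3 * ind d2 + 2 * ind a1 * ind a4 * ind c2 * ind c3 + ind a1 * ind a4 * ind c2 * ind d3 + ind a1 * ind a4 * ind c3 * ind d2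
      + 2 * ind a1 * ind a4 * ind d2 * ind d3 + 2 * ind a1 * ind b2 * ind b3 * ind b4 + ind a1 * ind b2 * ind b3 * ind c4 + ind a1 * ind b2 * ind b3 * ind d4
      + ind a1 * ind b2 * ind b4 * ind c3 + ind a1 * ind b2 * ind b4 * ind d3 + ind a1 * ind b2 * ind c3 * ind c4 + ind a1 * ind b2 * ind d3 * ind d4
      + ind a1 * ind b3 * ind b4 * ind c2 + ind a1 * ind b3 * ind b4 * ind d2 + ind a1 * ind b3 * ind c2 * ind c4 + ind a1 * ind b3 * ind d2 * ind d4
      + ind a1 * ind b4 * ind c2 * ind c3 + ind a1 * ind b4 * ind d2 * ind d3 + 2 * ind a1 * ind c2 * ind c3 * ind c4 + ind a1 * ind c2 * ind c3 * ind d4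
      + ind a1 * ind c2 * ind c4 * ind d3 + ind a1 * ind c2 * ind d3 * ind d4 + ind a1 * ind c3 * ind c4 * ind d2 + ind a1 * ind c3 * ind d2 * ind d4
      + ind a1 * ind c4 * ind d2 * ind d3 + 2 * ind a1 * ind d2 * ind d3 * ind d4 + 2 * ind a2 * ind a3 * ind a4 * ind b1 + 2 * ind a2 * ind a3 * ind a4 * ind c1
      + 2 * ind a2 * ind a3 * ind a4 * ind d1 + ind a2 * ind a3 * ind b1 * ind b4 + ind a2 * ind a3 * ind b1 * ind c4 + ind a2 * ind a3 * ind b1 * ind d4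
      + ind a2 * ind a3 * ind b4 * ind c1 + ind a2 * ind a3 * ind b4 * ind d1 + 2 * ind a2 * ind a3 * ind c1 * ind c4 + ind a2 * ind a3 * ind c1 * ind d4
      + ind a2 * ind a3 * ind c4 * ind d1 + 2 * ind a2 * ind a3 * ind d1 * ind d4 + ind a2 * ind a4 * ind b1 * ind b3 + ind a2 * ind a4 * ind b1 * ind c3
      + ind a2 * ind a4 * ind b1 * ind d3 + ind a2 * ind a4 * ind b3 * ind c1 + ind a2 * ind a4 * ind b3 * ind d1 + 2 * ind a2 * ind a4 * ind c1 * ind c3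
      + ind a2 * ind a4 * ind c1 * ind d3 + ind a2 * ind a4 * ind c3 * ind d1 + 2 * ind a2 * ind a4 * ind d1 * ind d3 + 2 * ind a2 * ind b1 * ind b3 * ind b4
      + ind a2 * ind b1 * ind b3 * ind c4 + ind a2 * ind b1 * ind b3 * ind d4 + ind a2 * ind b1 * ind b4 * ind c3 + ind a2 * ind b1 * ind b4 * ind d3
      + ind a2 * ind b1 * ind c3 * ind c4 + ind a2 * ind b1 * ind d3 * ind d4 + ind a2 * ind b3 * ind b4 * ind c1 + ind a2 * ind b3 * ind b4 * ind d1
      + ind a2 * ind b3 * ind c1 * ind c4 + ind a2 * ind b3 * ind d1 * ind d4 + ind a2 * ind b4 * ind c1 * ind c3 + ind a2 * ind b4 * ind d1 * ind d3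
      + 2 * ind a2 * ind c1 * ind c3 * ind c4 + ind a2 * ind c1 * ind c3 * ind d4 + ind a2 * ind c1 * ind c4 * ind d3 + ind a2 * ind c1 * ind d3 * ind d4
      + ind a2 * ind c3 * ind c4 * ind d1 + ind a2 * ind c3 * ind d1 * ind d4 + ind a2 * ind c4 * ind d1 * ind d3 + 2 * ind a2 * ind d1 * ind d3 * ind d4
      + ind a3 * ind a4 * ind b1 * ind b2 + ind a3 * ind a4 * ind b1 * ind c2 + ind a3 * ind a4 * ind b1 * ind d2 + ind a3 * ind a4 * ind b2 * ind c1
      + ind a3 * ind a4 * ind b2 * ind d1 + 2 * ind a3 * ind a4 * ind c1 * ind c2 + ind a3 * ind a4 * ind c1 * ind d2 + ind a3 * ind a4 * ind c2 * ind d1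
      + 2 * ind a3 * ind a4 * ind d1 * ind d2 + 2 * ind a3 * ind b1 * ind b2 * ind b4 + ind a3 * ind b1 * ind b2 * ind c4 + ind a3 * ind b1 * ind b2 * ind d4
      + ind a3 * ind b1 * ind b4 * ind c2 + ind a3 * ind b1 * ind b4 * ind d2 + ind a3 * ind b1 * ind c2 * ind c4 + ind a3 * ind b1 * ind d2 * ind d4
      + ind a3 * ind b2 * ind b4 * ind c1 + ind a3 * ind b2 * ind b4 * ind d1 + ind a3 * ind b2 * ind c1 * ind c4 + ind a3 * ind b2 * ind d1 * ind d4
      + ind a3 * ind b4 * ind c1 * ind c2 + ind a3 * ind b4 * ind d1 * ind d2 + 2 * ind a3 * ind c1 * ind c2 * ind c4 + ind a3 * ind c1 * ind c2 * ind d4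
      + ind a3 * ind c1 * ind c4 * ind d2 + ind a3 * ind c1 * ind d2 * ind d4 + ind a3 * ind c2 * ind c4 * ind d1 + ind a3 * ind c2 * ind d1 * ind d4
      + ind a3 * ind c4 * ind d1 * ind d2 + 2 * ind a3 * ind d1 * ind d2 * ind d4 + 2 * ind a4 * ind b1 * ind b2 * ind b3 + ind a4 * ind b1 * ind b2 * ind c3
      + ind a4 * ind b1 * ind b2 * ind d3 + ind a4 * ind b1 * ind b3 * ind c2 + ind a4 * ind b1 * ind b3 * ind d2 + ind a4 * ind b1 * ind c2 * ind c3
      + ind a4 * ind b1 * ind d2 * ind d3 + ind a4 * ind b2 * ind b3 * ind c1 + ind a4 * ind b2 * ind b3 * ind d1 + ind a4 * ind b2 * ind c1 * ind c3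
      + ind a4 * ind b2 * ind d1 * ind d3 + ind a4 * ind b3 * ind c1 * ind c2 + ind a4 * ind b3 * ind d1 * ind d2 + 2 * ind a4 * ind c1 * ind c2 * ind c3
      + ind a4 * ind c1 * ind c2 * ind d3 + ind a4 * ind c1 * ind c3 * ind d2 + ind a4 * ind c1 * ind d2 * ind d3 + ind a4 * ind c2 * ind c3 * ind d1
      + ind a4 * ind c2 * ind d1 * ind d3 + ind a4 * ind c3 * ind d1 * ind d2 + 2 * ind a4 * ind d1 * ind d2 * ind d3 + 4 * ind b1 * ind b2 * ind b3 * ind b4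
      + 2 * ind b1 * ind b2 * ind b3 * ind c4 + 2 * ind b1 * ind b2 * ind b3 * ind d4 + 2 * ind b1 * ind b2 * ind b4 * ind c3 + 2 * ind b1 * ind b2 * ind b4 * ind d3
      + 2 * ind b1 * ind b2 * ind c3 * ind c4 + ind b1 * ind b2 * ind c3 * ind d4 + ind b1 * ind b2 * ind c4 * ind d3 + 2 * ind b1 * ind b2 * ind d3 * ind d4
      + 2 * ind b1 * ind b3 * ind b4 * ind c2 + 2 * ind b1 * ind b3 * ind b4 * ind d2 + 2 * ind b1 * ind b3 * ind c2 * ind c4 + ind b1 * ind b3 * ind c2 * ind d4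
      + ind b1 * ind b3 * ind c4 * ind d2 + 2 * ind b1 * ind b3 * ind d2 * ind d4 + 2 * ind b1 * ind b4 * ind c2 * ind c3 + ind b1 * ind b4 * ind c2 * ind d3
      + ind b1 * ind b4 * ind c3 * ind d2 + 2 * ind b1 * ind b4 * ind d2 * ind d3 + 2 * ind b1 * ind c2 * ind c3 * ind c4 + ind b1 * ind c2 * ind c3 * ind d4
      + ind b1 * ind c2 * ind c4 * ind d3 + ind b1 * ind c2 * ind d3 * ind d4 + ind b1 * ind c3 * ind c4 * ind d2 + ind b1 * ind c3 * ind d2 * ind d4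
      + ind b1 * ind c4 * ind d2 * ind d3 + 2 * ind b1 * ind d2 * ind d3 * ind d4 + 2 * ind b2 * ind b3 * ind b4 * ind c1 + 2 * ind b2 * ind b3 * ind b4 * ind d1
      + 2 * ind b2 * ind b3 * ind c1 * ind c4 + ind b2 * ind b3 * ind c1 * ind d4 + ind b2 * ind b3 * ind c4 * ind d1 + 2 * ind b2 * ind b3 * ind d1 * ind d4
      + 2 * ind b2 * ind b4 * ind c1 * ind c3 + ind b2 * ind b4 * ind c1 * ind d3 + ind b2 * ind b4 * ind c3 * ind d1 + 2 * ind b2 * ind b4 * ind d1 * ind d3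
      + 2 * ind b2 * ind c1 * ind c3 * ind c4 + ind b2 * ind c1 * ind c3 * ind d4 + ind b2 * ind c1 * ind c4 * ind d3 + ind b2 * ind c1 * ind d3 * ind d4
      + ind b2 * ind c3 * ind c4 * ind d1 + ind b2 * ind c3 * ind d1 * ind d4 + ind b2 * ind c4 * ind d1 * ind d3 + 2 * ind b2 * ind d1 * ind d3 * ind d4
      + 2 * ind b3 * ind b4 * ind c1 * ind c2 + ind b3 * ind b4 * ind c1 * ind d2 + ind b3 * ind b4 * ind c2 * ind d1 + 2 * ind b3 * ind b4 * ind d1 * ind d2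
      + 2 * ind b3 * ind c1 * ind c2 * ind c4 + ind b3 * ind c1 * ind c2 * ind d4 + ind b3 * ind c1 * ind c4 * ind d2 + ind b3 * ind c1 * ind d2 * ind d4
      + ind b3 * ind c2 * ind c4 * ind d1 + ind b3 * ind c2 * ind d1 * ind d4 + ind b3 * ind c4 * ind d1 * ind d2 + 2 * ind b3 * ind d1 * ind d2 * ind d4
      + 2 * ind b4 * ind c1 * ind c2 * ind c3 + ind b4 * ind c1 * ind c2 * ind d3 + ind b4 * ind c1 * ind c3 * ind d2 + ind b4 * ind c1 * ind d2 * ind d3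
      + ind b4 * ind c2 * ind c3 * ind d1 + ind b4 * ind c2 * ind d1 * ind d3 + ind b4 * ind c3 * ind d1 * ind d2 + 2 * ind b4 * ind d1 * ind d2 * ind d3
      + 4 * ind c1 * ind c2 * ind c3 * ind c4 + 2 * ind c1 * ind c2 * ind c3 * ind d4 + 2 * ind c1 * ind c2 * ind c4 * ind d3 + ind c1 * ind c2 * ind d3 * ind d4
      + 2 * ind c1 * ind c3 * ind c4 * ind d2 + ind c1 * ind c3 * ind d2 * ind d4 + ind c1 * ind c4 * ind d2 * ind d3 + 2 * ind c1 * ind d2 * ind d3 * ind d4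
      + 2 * ind c2 * ind c3 * ind c4 * ind d1 + ind c2 * ind c3 * ind d1 * ind d4 + ind c2 * ind c4 * ind d1 * ind d3 + 2 * ind c2 * ind d1 * ind d3 * ind d4
      + ind c3 * ind c4 * ind d1 * ind d2 + 2 * ind c3 * ind d1 * ind d2 * ind d4 + 2 * ind c4 * ind d1 * ind d2 * ind d3 + 4 * ind d1 * ind d2 * ind d3 * ind d4) * two_eq_zero

/-! ### Translation by the base point -/

/-- A constant sums to `0` over the sixteen corners. [folklore] -/
theorem cfs_sum_const16 (cst : ZMod 2) : (∑ _q : (Bool × Bool) × (Bool × Bool), cst) = 0 := by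
  simp only [Fintype.sum_prod_type, Fintype.sum_bool]
  linear_combination (8 * cst) * two_eq_zero

/-- Splitting the base bit off a based frame form: `[w ⊕ A ⊕ B ⊕ C ⊕ D] = [w] + [A ⊕ B ⊕ C ⊕ D]`. [folklore] -/
theorem cfs_ind_xor5 (w A B C D : Bool) : ind (w ^^ A ^^ B ^^ C ^^ D) = ind w + ind (A ^^ B ^^ C ^^ D) := by
  cases w <;> cases A <;> cases B <;> cases C <;> cases D <;> decide

/-- Expansion of a product of three translated forms: all sixteen-corner sums of `≤ 3` forms vanish, hence so
does the translated one. [folklore] -/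
theorem cfs_expand3 (W₁ W₂ W₃ : ZMod 2) (Z₁ Z₂ Z₃ : (Bool × Bool) × (Bool × Bool) → ZMod 2)
    (h₁ : (∑ q, Z₁ q) = 0) (h₂ : (∑ q, Z₂ q) = 0) (h₃ : (∑ q, Z₃ q) = 0)
    (h₁₂ : (∑ q, Z₁ q * Z₂ q) = 0) (h₁₃ : (∑ q, Z₁ q * Z₃ q) = 0) (h₂₃ : (∑ q, Z₂ q * Z₃ q) = 0)
    (h₁₂₃ : (∑ q, Z₁ q * (Z₂ q * Z₃ q)) = 0) :
    (∑ q, (W₁ + Z₁ q) * ((W₂ + Z₂ q) * (W₃ + Z₃ q))) = 0 := by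
  have key : ∀ q, (W₁ + Z₁ q) * ((W₂ + Z₂ q) * (W₃ + Z₃ q)) =
      Z₁ q * (Z₂ q * Z₃ q) + W₃ * (Z₁ q * Z₂ q) + W₂ * (Z₁ q * Z₃ q) + W₁ * (Z₂ q * Z₃ q) +
        W₂ * W₃ * Z₁ q + W₁ * W₃ * Z₂ q + W₁ * W₂ * Z₃ q + W₁ * W₂ * W₃ := fun q => by ring
  simp only [key, sum_add_distrib, ← mul_sum, h₁, h₂, h₃, h₁₂, h₁₃, h₂₃, h₁₂₃, mul_zero, add_zero,
    cfs_sum_const16]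

/-- Expansion of a product of four translated forms: only the top product survives. [folklore] -/
theorem cfs_expand4 (W₁ W₂ W₃ W₄ : ZMod 2) (Z₁ Z₂ Z₃ Z₄ : (Bool × Bool) × (Bool × Bool) → ZMod 2)
    (h₁ : (∑ q, Z₁ q) = 0) (h₂ : (∑ q, Z₂ q) = 0) (h₃ : (∑ q, Z₃ q) = 0) (h₄ : (∑ q, Z₄ q) = 0)
    (h₁₂ : (∑ q, Z₁ q * Z₂ q) = 0) (h₁₃ : (∑ q, Z₁ q * Z₃ q) = 0) (h₁₄ : (∑ q, Z₁ q * Z₄ q) = 0)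
    (h₂₃ : (∑ q, Z₂ q * Z₃ q) = 0) (h₂₄ : (∑ q, Z₂ q * Z₄ q) = 0) (h₃₄ : (∑ q, Z₃ q * Z₄ q) = 0)
    (h₁₂₃ : (∑ q, Z₁ q * (Z₂ q * Z₃ q)) = 0) (h₁₂₄ : (∑ q, Z₁ q * (Z₂ q * Z₄ q)) = 0)
    (h₁₃₄ : (∑ q, Z₁ q * (Z₃ q * Z₄ q)) = 0) (h₂₃₄ : (∑ q, Z₂ q * (Z₃ q * Z₄ q)) = 0) :
    (∑ q, (W₁ + Z₁ q) * ((W₂ + Z₂ q) * ((W₃ + Z₃ q) * (W₄ + Z₄ q)))) =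
      ∑ q, Z₁ q * (Z₂ q * (Z₃ q * Z₄ q)) := by
  have key : ∀ q, (W₁ + Z₁ q) * ((W₂ + Z₂ q) * ((W₃ + Z₃ q) * (W₄ + Z₄ q))) =
      Z₁ q * (Z₂ q * (Z₃ q * Z₄ q)) + W₄ * (Z₁ q * (Z₂ q * Z₃ q)) + W₃ * (Z₁ q * (Z₂ q * Z₄ q)) +
        W₂ * (Z₁ q * (Z₃ q * Z₄ q)) + W₁ * (Z₂ q * (Z₃ q * Z₄ q)) + W₃ * W₄ * (Z₁ q * Z₂ q) +
        W₂ * W₄ * (Z₁ q * Z₃ q) + W₂ * W₃ * (Z₁ q * Z₄ q) + W₁ * W₄ * (Z₂ q * Z₃ q) +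
        W₁ * W₃ * (Z₂ q * Z₄ q) + W₁ * W₂ * (Z₃ q * Z₄ q) + W₂ * W₃ * W₄ * Z₁ q + W₁ * W₃ * W₄ * Z₂ q +
        W₁ * W₂ * W₄ * Z₃ q + W₁ * W₂ * W₃ * Z₄ q + W₁ * W₂ * W₃ * W₄ := fun q => by ring
  simp only [key, sum_add_distrib, ← mul_sum, h₁, h₂, h₃, h₄, h₁₂, h₁₃, h₁₄, h₂₃, h₂₄, h₃₄, h₁₂₃, h₁₂₄, h₁₃₄,
    h₂₃₄, mul_zero, add_zero, cfs_sum_const16]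

/-! ### Based sixteen-corner sums (corners `w ⊕ q₁₁u₁ ⊕ q₁₂u₂ ⊕ q₂₁u₃ ⊕ q₂₂u₄`) -/

/-- One coordinate: `Σ_q [corner_t(q)] = 0`. [folklore] -/
theorem cfs_based1 : ∀ w a b c d : Bool,
    (∑ q : (Bool × Bool) × (Bool × Bool), ind (w ^^ (q.1.1 && a) ^^ (q.1.2 && b) ^^ (q.2.1 && c) ^^ (q.2.2 && d))) = 0 := by
  intro w a b c d
  simp only [Fintype.sum_prod_type, Fintype.sum_bool]
  cases w <;> cases a <;> cases b <;> cases c <;> cases d <;> decide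

/-- Two coordinates: `Σ_q [corner_s(q)][corner_t(q)] = 0`. [folklore] -/
theorem cfs_based2 : ∀ w a b c d w' a' b' c' d' : Bool,
    (∑ q : (Bool × Bool) × (Bool × Bool), ind (w ^^ (q.1.1 && a) ^^ (q.1.2 && b) ^^ (q.2.1 && c) ^^ (q.2.2 && d)) *
      ind (w' ^^ (q.1.1 && a') ^^ (q.1.2 && b') ^^ (q.2.1 && c') ^^ (q.2.2 && d'))) = 0 := by
  intro w a b c d w'
  simp only [Fintype.sum_prod_type, Fintype.sum_bool]
  cases w <;> cases a <;> cases b <;> cases c <;> cases d <;> cases w' <;> decide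

/-- Three coordinates: `Σ_q [corner_r(q)][corner_s(q)][corner_t(q)] = 0`. [folklore] -/
theorem cfs_based3 (w a b c d w' a' b' c' d' w'' a'' b'' c'' d'' : Bool) :
    (∑ q : (Bool × Bool) × (Bool × Bool), ind (w ^^ (q.1.1 && a) ^^ (q.1.2 && b) ^^ (q.2.1 && c) ^^ (q.2.2 && d)) *
      (ind (w' ^^ (q.1.1 && a') ^^ (q.1.2 && b') ^^ (q.2.1 && c') ^^ (q.2.2 && d')) *
        ind (w'' ^^ (q.1.1 && a'') ^^ (q.1.2 && b'') ^^ (q.2.1 && c'') ^^ (q.2.2 && d'')))) = 0 := by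
  simp only [cfs_ind_xor5]
  exact cfs_expand3 (ind w) (ind w') (ind w'')
    (fun q => ind (((q.1.1 && a) ^^ (q.1.2 && b)) ^^ (q.2.1 && c) ^^ (q.2.2 && d)))
    (fun q => ind (((q.1.1 && a') ^^ (q.1.2 && b')) ^^ (q.2.1 && c') ^^ (q.2.2 && d')))
    (fun q => ind (((q.1.1 && a'') ^^ (q.1.2 && b'')) ^^ (q.2.1 && c'') ^^ (q.2.2 && d'')))
    (cfz_sum1 _ _ _ _) (cfz_sum1 _ _ _ _) (cfz_sum1 _ _ _ _) (cfz_sum2 _ _ _ _ _ _ _ _) (cfz_sum2 _ _ _ _ _ _ _ _)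
    (cfz_sum2 _ _ _ _ _ _ _ _) (cfz_sum3 _ _ _ _ _ _ _ _ _ _ _ _)

/-- **Four coordinates: the based sixteen-corner sum is the Pfaffian**, independent of the base point.
[folklore] -/
theorem cfs_based4 (w1 a1 b1 c1 d1 w2 a2 b2 c2 d2 w3 a3 b3 c3 d3 w4 a4 b4 c4 d4 : Bool) :
    (∑ q : (Bool × Bool) × (Bool × Bool), ind (w1 ^^ (q.1.1 && a1) ^^ (q.1.2 && b1) ^^ (q.2.1 && c1) ^^ (q.2.2 && d1)) *
      (ind (w2 ^^ (q.1.1 && a2) ^^ (q.1.2 && b2) ^^ (q.2.1 && c2) ^^ (q.2.2 && d2)) *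
        (ind (w3 ^^ (q.1.1 && a3) ^^ (q.1.2 && b3) ^^ (q.2.1 && c3) ^^ (q.2.2 && d3)) *
          ind (w4 ^^ (q.1.1 && a4) ^^ (q.1.2 && b4) ^^ (q.2.1 && c4) ^^ (q.2.2 && d4))))) =
      ind (((((a1 && b2) ^^ (a2 && b1)) ^^ ((c1 && d2) ^^ (c2 && d1))) && (((a3 && b4) ^^ (a4 && b3)) ^^ ((c3 && d4) ^^ (c4 && d3)))) ^^ ((((a1 && b3) ^^ (a3 && b1)) ^^ ((c1 && d3) ^^ (c3 && d1))) && (((a2 && b4) ^^ (a4 && b2)) ^^ ((c2 && d4) ^^ (c4 && d2)))) ^^ ((((a1 && b4) ^^ (a4 && b1)) ^^ ((c1 && d4) ^^ (c4 && d1))) && (((a2 && b3) ^^ (a3 && b2)) ^^ ((c2 && d3) ^^ (c3 && d2))))) := by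
  simp only [cfs_ind_xor5]
  exact (cfs_expand4 (ind w1) (ind w2) (ind w3) (ind w4)
    (fun q => ind (((q.1.1 && a1) ^^ (q.1.2 && b1)) ^^ (q.2.1 && c1) ^^ (q.2.2 && d1)))
    (fun q => ind (((q.1.1 && a2) ^^ (q.1.2 && b2)) ^^ (q.2.1 && c2) ^^ (q.2.2 && d2)))
    (fun q => ind (((q.1.1 && a3) ^^ (q.1.2 && b3)) ^^ (q.2.1 && c3) ^^ (q.2.2 && d3)))
    (fun q => ind (((q.1.1 && a4) ^^ (q.1.2 && b4)) ^^ (q.2.1 && c4) ^^ (q.2.2 && d4)))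
    (cfz_sum1 _ _ _ _) (cfz_sum1 _ _ _ _) (cfz_sum1 _ _ _ _) (cfz_sum1 _ _ _ _)
    (cfz_sum2 _ _ _ _ _ _ _ _) (cfz_sum2 _ _ _ _ _ _ _ _) (cfz_sum2 _ _ _ _ _ _ _ _)
    (cfz_sum2 _ _ _ _ _ _ _ _) (cfz_sum2 _ _ _ _ _ _ _ _) (cfz_sum2 _ _ _ _ _ _ _ _)
    (cfz_sum3 _ _ _ _ _ _ _ _ _ _ _ _) (cfz_sum3 _ _ _ _ _ _ _ _ _ _ _ _) (cfz_sum3 _ _ _ _ _ _ _ _ _ _ _ _)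
    (cfz_sum3 _ _ _ _ _ _ _ _ _ _ _ _)).trans (cfz_sum4 _ _ _ _ _ _ _ _ _ _ _ _ _ _ _ _)

/-! ### Sixteen-corner sums of a monomial `y_S` over a rank-4 corner flat -/

/-- For `|S| ≤ 3` the sixteen-corner sum of `Π_{t∈S} [corner_t]` vanishes. [folklore] -/
theorem cfs_flat_sum_le3 (w u₁ u₂ u₃ u₄ : Fin m → Bool) (S : Finset (Fin m)) (hS : S.card ≤ 3) :
    (∑ q : (Bool × Bool) × (Bool × Bool), ∏ t ∈ S,
      ind (w t ^^ (q.1.1 && u₁ t) ^^ (q.1.2 && u₂ t) ^^ (q.2.1 && u₃ t) ^^ (q.2.2 && u₄ t))) = 0 := by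
  have hc : S.card = 0 ∨ S.card = 1 ∨ S.card = 2 ∨ S.card = 3 := by omega
  rcases hc with hc | hc | hc | hc
  · rw [Finset.card_eq_zero] at hc
    subst hc
    simp only [prod_empty]
    exact cfs_sum_const16 1
  · obtain ⟨i, rfl⟩ := Finset.card_eq_one.mp hc
    simp only [prod_singleton]
    exact cfs_based1 _ _ _ _ _
  · obtain ⟨i, j, hij, rfl⟩ := Finset.card_eq_two.mp hc
    have hi : i ∉ ({j} : Finset (Fin m)) := by simpa using hij
    simp only [prod_insert hi, prod_singleton]
    exact cfs_based2 _ _ _ _ _ _ _ _ _ _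
  · obtain ⟨i, j, k, hij, hik, hjk, rfl⟩ := Finset.card_eq_three.mp hc
    have hi : i ∉ ({j, k} : Finset (Fin m)) := by simp [hij, hik]
    have hj : j ∉ ({k} : Finset (Fin m)) := by simpa using hjk
    simp only [prod_insert hi, prod_insert hj, prod_singleton]
    exact cfs_based3 _ _ _ _ _ _ _ _ _ _ _ _ _ _ _

/-- For `S = {i,j,k,l}` (four distinct coordinates) the sixteen-corner sum of `Π_{t∈S} [corner_t]` is the
Pfaffian `B_ij B_kl ⊕ B_ik B_jl ⊕ B_il B_jk` of `B = u₁∧u₂ ⊕ u₃∧u₄`. [folklore] -/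
theorem cfs_flat_sum4 (w u₁ u₂ u₃ u₄ : Fin m → Bool) {i j k l : Fin m}
    (hi : i ∉ ({j, k, l} : Finset (Fin m))) (hj : j ∉ ({k, l} : Finset (Fin m))) (hk : k ∉ ({l} : Finset (Fin m))) :
    (∑ q : (Bool × Bool) × (Bool × Bool), ∏ t ∈ ({i, j, k, l} : Finset (Fin m)),
      ind (w t ^^ (q.1.1 && u₁ t) ^^ (q.1.2 && u₂ t) ^^ (q.2.1 && u₃ t) ^^ (q.2.2 && u₄ t))) =
      ind ((((((u₁ i && u₂ j) ^^ (u₁ j && u₂ i)) ^^ ((u₃ i && u₄ j) ^^ (u₃ j && u₄ i))) && (((u₁ k && u₂ l) ^^ (u₁ l && u₂ k)) ^^ ((u₃ k && u₄ l) ^^ (u₃ l && u₄ k)))) ^^ ((((u₁ i && u₂ k) ^^ (u₁ k && u₂ i)) ^^ ((u₃ i && u₄ k) ^^ (u₃ k && u₄ i))) && (((u₁ j && u₂ l) ^^ (u₁ l && u₂ j)) ^^ ((u₃ j && u₄ l) ^^ (u₃ l && u₄ j)))) ^^ ((((u₁ i && u₂ l) ^^ (u₁ l && u₂ i)) ^^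 ((u₃ i && u₄ l) ^^ (u₃ l && u₄ i))) && (((u₁ j && u₂ k) ^^ (u₁ k && u₂ j)) ^^ ((u₃ j && u₄ k) ^^ (u₃ k && u₄ j)))))) := by
  simp only [prod_insert hi, prod_insert hj, prod_insert hk, prod_singleton]
  exact cfs_based4 _ _ _ _ _ _ _ _ _ _ _ _ _ _ _ _ _ _ _ _

end Summit.QuantumAdvantage.QuantumAdvantage.Theorems.NearExactIsExact.Negative.CornerFlatRankFour

end
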